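import Literature.NumberTheory.Automorphic.ResGLnCuspidalCohomologyApex
import Literature.NumberTheory.Automorphic.CompactOpenAveraging
import Literature.NumberTheory.Automorphic.AutomorphicFormsProofs
import Literature.NumberTheory.Automorphic.AutomorphyDatumGLRegular
import Literature.NumberTheory.Automorphic.AutomorphicRepDataSplitCenter
import Literature.NumberTheory.Automorphic.GLnCuspidalSpectrumSiegel
import Literature.NumberTheory.Automorphic.GKCohomologyFunctor
import HarnessLib

/-!
# Clozel's cocycle (apex fact (a′)): the level retraction `e_{K(𝔫)} ⊗ 1` and the reduction to the
# LEVEL-FIXED subcomplex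

Topic `NumberTheory/Automorphic`; namespace `Literature.NumberTheory.Automorphic.ConeDictionary` (the
vocabulary of `ResGLnConeDictionary` / `ResGLnCuspidalCohomologyApex`: the complex
`gkComplexLS π S λ = C^•(𝔤, K_∞; W ⊗ (E_λ(ℂ) ⊗ ε_S))` of the SPACE `W` of an automorphic representation
`π` of `GL_n(𝔸_K)`, its cochains `Cochain π λ q`, and level-fixed cochains `IsLevelFixed π λ 𝔫`).
Definitions with bodies and theorems; no named fact, no `sorry` (D-0026: a brick of the proof of the
apex fact `ConeDictionary.Clozel1990_exists_basic_levelFixed_cocycle`, not a restatement of it).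

The printed proof of the apex fact [cite: Clozel1990, Lemme 3.14 (p. 114) and §3.5 (pp. 121–123)] produces
a class of `H^•(𝔤, K_∞; π_∞ ⊗ E) ⊗ π_f^{K_f} = H^•(𝔤, K_∞; W^{K_f} ⊗ E)` — a cocycle with values in the
`K_f`-INVARIANTS `W^{K_f} ⊗ E` which is not the coboundary of a cochain with values in `W^{K_f} ⊗ E` —
and uses, silently, that `W^{K_f}` is a `(𝔤, K_∞)`-direct summand of the smooth `G(𝔸_f)`-module `W`
(the idempotent `e_{K_f} = vol(K_f)⁻¹ 1_{K_f}` of the Hecke algebra commutes with `(𝔤, K_∞)`), so that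
such a cocycle is not a coboundary in `C^•(𝔤, K_∞; W ⊗ E)` either.  THIS FILE proves that step in the
tree's vocabulary, for every automorphic representation datum `π` of `GL_n(𝔸_K)` and every `𝔫 ≠ 0`:

* `levelFin 𝔫` — `K(𝔫)` as a subgroup of the finite-adelic group `G(𝔸_f)` of the datum; compact
  (`isCompact_levelFin`); `finiteRepW_isSmooth` — `W` is a smooth `G(𝔸_f)`-module (every automorphic
  form is right invariant under an open level);
* `levelProj π h𝔫 : W →ₗ[ℂ] W` — **the averaging projector `e_{K(𝔫)}`** (`Representation.avgProjLinear`
  of `CompactOpenAveraging`, a finite sum over a transversal of `K(𝔫)/(K(𝔫) ∩ Stab φ)`): its values are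
  `K(𝔫)`-fixed (`finiteRepW_levelProj`), it is the identity on `K(𝔫)`-fixed vectors
  (`levelProj_eq_self`), and it COMMUTES with `K_∞` (`levelProj_kRepW`) and with `𝔤`
  (`levelProj_lieRepW`) — right translations by `G(𝔸_f)` commute with the archimedean operations;
* `levelProjCochain π S λ h𝔫 q` — the cochain map `η ↦ (e_{K(𝔫)} ⊗ 1) ∘ η` of the complex
  `gkComplexLS π S λ` (`isCochainMapTo_levelProjCochain`), with level-fixed values
  (`isLevelFixed_levelProjCochain`) and the identity on level-fixed cochains
  (`levelProjCochain_eq_self`);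
* `not_mem_coboundaries_of_isLevelFixed` — **a level-fixed cochain which is not the coboundary of a
  LEVEL-FIXED cochain of the complex is not a coboundary**;
* `Clozel1990_exists_basic_levelFixed_cocycle_of_levelSubcomplex` — hence the apex fact follows from
  its LEVEL-FIXED form: a basic level-fixed cocycle which is not the coboundary of a level-fixed cochain.

## References

* L. Clozel, *Motifs et formes automorphes: applications du principe de fonctorialité*, in:
  Automorphic forms, Shimura varieties, and L-functions I (Ann Arbor 1988), Perspect. Math. 10 (1990),
  Lemme 3.14 (p. 114), Lemme 3.15 (p. 121), §3.5 (pp. 121–123). [Clozel1990]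
* A. Borel, N. Wallach, *Continuous cohomology, discrete subgroups, and representations of reductive
  groups*, 2nd ed. (2000), I §5.1, VII 2.2–2.7. [BorelWallach2000]
* J. Bernstein, A. Zelevinsky, Russian Math. Surveys 31 (1976), §2.3 (the idempotents `e_K`).
  [BernsteinZelevinsky1976]
-/

noncomputable section

open scoped Classical TensorProduct
open NumberField IsDedekindDomain

namespace Literature.NumberTheory.Automorphic

namespace ConeDictionary

open ResGLnCohomology BigHeckeGLn

variable {n : ℕ} {K : Type} [Field K] [NumberField K] {hcpt : isCompact_glFiniteIntegralLevel n K}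
  (π : AutomorphicRepData (AutomorphyDatum.gl n K hcpt))
  (S : Finset {w : InfinitePlace K // w.IsReal}) (lam : (K →+* ℂ) → Fin n → ℤ)

/-! ### The level `K(𝔫)` inside `G(𝔸_f)`; smoothness of `W` -/

section Level

variable (n K hcpt) in
/-- The principal congruence subgroup `K(𝔫)` as a subgroup of the finite-adelic group `G(𝔸_f)` of the
`GL_n` datum (`K(𝔫) = {1} × K_f(𝔫) ≤ G(𝔸_f)`). [folklore] -/
def levelFin (𝔫 : Ideal (𝓞 K)) : Subgroup (AutomorphyDatum.gl n K hcpt).finiteAdelic :=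
  (principalCongruenceLevel n K 𝔫).comap (AutomorphyDatum.gl n K hcpt).finiteAdelic.subtype

/-- Membership in `levelFin`: the underlying adelic element lies in `K(𝔫)`. [folklore] -/
theorem mem_levelFin_iff {𝔫 : Ideal (𝓞 K)} (u : (AutomorphyDatum.gl n K hcpt).finiteAdelic) :
    u ∈ levelFin n K hcpt 𝔫 ↔ (u : (AdelicGroupData.gl n K).Adelic) ∈ principalCongruenceLevel n K 𝔫 :=
  Iff.rfl

/-- The finite-adelic point of `u ∈ K_f(𝔫)` lies in `levelFin 𝔫`. [folklore] -/
theorem ofFinite_mem_levelFin {𝔫 : Ideal (𝓞 K)} {u : BigHeckeGLn.FiniteAdelicGL n K}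
    (hu : u ∈ ResGLnCohomology.level n K 𝔫) :
    (⟨GLn.ofFinite n K u, u, rfl⟩ : (AutomorphyDatum.gl n K hcpt).finiteAdelic) ∈ levelFin n K hcpt 𝔫 :=
  hu

/-- Every element of `levelFin 𝔫` is the finite-adelic point of an element of `K_f(𝔫)`. [folklore] -/
theorem exists_eq_ofFinite_of_mem_levelFin {𝔫 : Ideal (𝓞 K)} {u : (AutomorphyDatum.gl n K hcpt).finiteAdelic}
    (hu : u ∈ levelFin n K hcpt 𝔫) :
    ∃ u' : BigHeckeGLn.FiniteAdelicGL n K, u' ∈ ResGLnCohomology.level n K 𝔫 ∧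
      u = ⟨GLn.ofFinite n K u', u', rfl⟩ := by
  obtain ⟨u', hu'⟩ := u.2
  refine ⟨u', ?_, Subtype.ext hu'.symm⟩
  change GLn.ofFinite n K u' ∈ principalCongruenceLevel n K 𝔫
  rw [hu']
  exact hu

/-- `levelFin 𝔫` is compact for `𝔫 ≠ 0` (the inclusion `G(𝔸_f) ↪ G(𝔸_K)` is an embedding and
`K(𝔫) ⊆ G(𝔸_f)` is compact). [folklore] -/
theorem isCompact_levelFin {𝔫 : Ideal (𝓞 K)} (h𝔫 : 𝔫 ≠ 0) :
    IsCompact (levelFin n K hcpt 𝔫 : Set (AutomorphyDatum.gl n K hcpt).finiteAdelic) := by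
  rw [Topology.IsEmbedding.subtypeVal.isCompact_iff]
  have himg : Subtype.val '' (levelFin n K hcpt 𝔫 : Set (AutomorphyDatum.gl n K hcpt).finiteAdelic) =
      ((principalCongruenceLevel n K 𝔫 : Subgroup (GL (Fin n) (AdeleRing (𝓞 K) K))) :
        Set (GL (Fin n) (AdeleRing (𝓞 K) K))) := by
    ext x
    constructor
    · rintro ⟨u, hu, rfl⟩
      exact hu
    · intro hx
      obtain ⟨u, hu, rfl⟩ : x ∈ (finitePrincipalCongruenceLevel n K 𝔫).map (GLn.ofFinite n K) := by
        rw [map_ofFinite_finitePrincipalCongruenceLevel]; exact hx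
      exact ⟨⟨GLn.ofFinite n K u, u, rfl⟩, hx, rfl⟩
  rw [himg]
  exact isCompact_principalCongruenceLevel n K h𝔫

/-- **`W` is a smooth `G(𝔸_f)`-module**: every `φ ∈ W` has open stabiliser in `G(𝔸_f)` (automorphic
forms are right invariant under a level, levels are open for the regular `GL_n` datum, and smooth
vectors form a subspace). [cite: BorelWallach2000, I §5.1] -/
theorem finiteRepW_isSmooth : π.finiteRepW.IsSmooth := fun φ => by
  refine π.finiteRepW.isSmoothVector_of_le
    (isSmoothVector_of_mem_automorphicForms (AutomorphyDatum.gl n K hcpt) (AutomorphyDatum.isRegular_gl hcpt)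
      (π.stable.le_automorphicForms φ.2)) fun u hu => ?_
  simp only [Representation.mem_stabilizerSubgroup] at hu ⊢
  exact Subtype.ext hu

end Level

/-! ### The averaging projector `e_{K(𝔫)}` on `W` -/

section Proj

variable {𝔫 : Ideal (𝓞 K)} (h𝔫 : 𝔫 ≠ 0)

/-- **The averaging projector `e_{K(𝔫)} : W → W`**, `φ ↦ [K(𝔫) : K(𝔫) ∩ Stab φ]⁻¹ ∑_{r} r · φ`
(`Representation.avgProjLinear` for the smooth `G(𝔸_f)`-module `W` and the compact subgroup `K(𝔫)`).
[cite: BernsteinZelevinsky1976, §2.3] -/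
def levelProj : π.W →ₗ[ℂ] π.W :=
  π.finiteRepW.avgProjLinear (levelFin n K hcpt 𝔫) (finiteRepW_isSmooth π) (isCompact_levelFin h𝔫)

/-- Unfolding. [folklore] -/
theorem levelProj_apply (φ : π.W) :
    levelProj π h𝔫 φ = π.finiteRepW.avgProj (levelFin n K hcpt 𝔫) φ :=
  rfl

/-- The values of `e_{K(𝔫)}` are `K(𝔫)`-fixed. [cite: BernsteinZelevinsky1976, §2.3] -/
theorem finiteRepW_levelProj {u : (AutomorphyDatum.gl n K hcpt).finiteAdelic} (hu : u ∈ levelFin n K hcpt 𝔫)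
    (φ : π.W) : π.finiteRepW u (levelProj π h𝔫 φ) = levelProj π h𝔫 φ :=
  Representation.apply_avgProj (isCompact_levelFin h𝔫) (finiteRepW_isSmooth π φ) hu

/-- As linear maps: `r(u) ∘ e_{K(𝔫)} = e_{K(𝔫)}` for `u ∈ K(𝔫)`. [cite: BernsteinZelevinsky1976, §2.3] -/
theorem finiteRepW_comp_levelProj {u : (AutomorphyDatum.gl n K hcpt).finiteAdelic} (hu : u ∈ levelFin n K hcpt 𝔫) :
    (π.finiteRepW u) ∘ₗ levelProj π h𝔫 = levelProj π h𝔫 :=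
  LinearMap.ext fun φ => finiteRepW_levelProj π h𝔫 hu φ

/-- `e_{K(𝔫)}` is the identity on `K(𝔫)`-fixed vectors (computed with the open stabiliser of the
vector: every representative fixes it). [cite: BernsteinZelevinsky1976, §2.3] -/
theorem levelProj_eq_self {φ : π.W} (hφ : ∀ u ∈ levelFin n K hcpt 𝔫, π.finiteRepW u φ = φ) :
    levelProj π h𝔫 φ = φ := by
  obtain ⟨R, hR⟩ := exists_isLeftTransversal (B := levelFin n K hcpt 𝔫) (isCompact_levelFin h𝔫)
    (finiteRepW_isSmooth π φ)
  have hfix : ∀ t ∈ π.finiteRepW.stabilizerSubgroup φ, π.finiteRepW t φ = φ := fun t ht => ht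
  rw [levelProj_apply, Representation.avgProj_eq (isCompact_levelFin h𝔫) (finiteRepW_isSmooth π φ) hfix hR]
  have hsum : ∑ r ∈ R, π.finiteRepW r φ = R.card • φ := by
    rw [← Finset.sum_const]
    exact Finset.sum_congr rfl fun r hr => hφ r (hR.mem_of_mem r hr)
  rw [hsum, ← Nat.cast_smul_eq_nsmul ℂ, smul_smul,
    inv_mul_cancel₀ (Nat.cast_ne_zero.2 (Finset.card_ne_zero.2 hR.nonempty)), one_smul]

/-- **`e_{K(𝔫)}` commutes with every operator commuting with the right translations by `G(𝔸_f)`**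
(both sides are computed with the open stabiliser of `φ`, which also fixes `A φ`). [folklore] -/
theorem levelProj_comm {A : π.W →ₗ[ℂ] π.W}
    (hA : ∀ u : (AutomorphyDatum.gl n K hcpt).finiteAdelic, A ∘ₗ π.finiteRepW u = π.finiteRepW u ∘ₗ A)
    (φ : π.W) : levelProj π h𝔫 (A φ) = A (levelProj π h𝔫 φ) := by
  have hT : IsOpen ((π.finiteRepW.stabilizerSubgroup φ : Subgroup (AutomorphyDatum.gl n K hcpt).finiteAdelic) :
      Set (AutomorphyDatum.gl n K hcpt).finiteAdelic) := finiteRepW_isSmooth π φ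
  obtain ⟨R, hR⟩ := exists_isLeftTransversal (B := levelFin n K hcpt 𝔫) (isCompact_levelFin h𝔫) hT
  have hTφ : ∀ t ∈ π.finiteRepW.stabilizerSubgroup φ, π.finiteRepW t φ = φ := fun t ht => ht
  have hTA : ∀ t ∈ π.finiteRepW.stabilizerSubgroup φ, π.finiteRepW t (A φ) = A φ := fun t ht => by
    rw [← LinearMap.comp_apply, ← hA t, LinearMap.comp_apply, hTφ t ht]
  rw [levelProj_apply, levelProj_apply, Representation.avgProj_eq (isCompact_levelFin h𝔫) hT hTA hR,
    Representation.avgProj_eq (isCompact_levelFin h𝔫) hT hTφ hR, map_smul, map_sum]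
  congr 1
  refine Finset.sum_congr rfl fun r _ => ?_
  rw [← LinearMap.comp_apply, ← hA r, LinearMap.comp_apply]

/-- Right translations by `K_∞` and by `G(𝔸_f)` commute on `W` (`G_∞` and `G(𝔸_f)` commute in
`G(𝔸_K)`). [folklore] -/
theorem kRepW_comp_finiteRepW (k : (AutomorphyDatum.gl n K hcpt).arch.maximalCompact)
    (u : (AutomorphyDatum.gl n K hcpt).finiteAdelic) :
    π.kRepW k ∘ₗ π.finiteRepW u = π.finiteRepW u ∘ₗ π.kRepW k := by
  refine LinearMap.ext fun φ => Subtype.ext ?_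
  change rightTranslation (AdelicGroupData.gl n K) ((AutomorphyDatum.gl n K hcpt).ofK k)
      (rightTranslation (AdelicGroupData.gl n K) (u : (AdelicGroupData.gl n K).Adelic) φ) =
    rightTranslation (AdelicGroupData.gl n K) (u : (AdelicGroupData.gl n K).Adelic)
      (rightTranslation (AdelicGroupData.gl n K) ((AutomorphyDatum.gl n K hcpt).ofK k) φ)
  rw [← Module.End.mul_apply, ← map_mul, ← Module.End.mul_apply, ← map_mul, AutomorphyDatum.ofK_apply,
    (AutomorphyDatum.gl n K hcpt).commute_ofArch _ _ u.2]

/-- Lie derivatives along `𝔤` and right translations by `G(𝔸_f)` commute on `W`. [folklore] -/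
theorem lieRepW_comp_finiteRepW (X : (AutomorphyDatum.gl n K hcpt).arch.lie)
    (u : (AutomorphyDatum.gl n K hcpt).finiteAdelic) :
    π.lieRepW X ∘ₗ π.finiteRepW u = π.finiteRepW u ∘ₗ π.lieRepW X := by
  refine LinearMap.ext fun φ => Subtype.ext ?_
  exact lieDeriv_rightTranslation_of_forall_commute X
    (fun t => (AutomorphyDatum.gl n K hcpt).commute_ofArch _ _ u.2) (φ : (AdelicGroupData.gl n K).Adelic → ℂ)

/-- **`e_{K(𝔫)}` commutes with `K_∞`.** [cite: BorelWallach2000, I §5.1] -/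
theorem levelProj_kRepW (k : (AutomorphyDatum.gl n K hcpt).arch.maximalCompact) (φ : π.W) :
    levelProj π h𝔫 (π.kRepW k φ) = π.kRepW k (levelProj π h𝔫 φ) :=
  levelProj_comm π h𝔫 (kRepW_comp_finiteRepW π k) φ

/-- **`e_{K(𝔫)}` commutes with `𝔤`.** [cite: BorelWallach2000, I §5.1] -/
theorem levelProj_lieRepW (X : (AutomorphyDatum.gl n K hcpt).arch.lie) (φ : π.W) :
    levelProj π h𝔫 (π.lieRepW X φ) = π.lieRepW X (levelProj π h𝔫 φ) :=
  levelProj_comm π h𝔫 (lieRepW_comp_finiteRepW π X) φ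

end Proj

/-! ### `e_{K(𝔫)} ⊗ 1` on `W ⊗ E` and the induced cochain map -/

section Tensor

variable {𝔫 : Ideal (𝓞 K)} (h𝔫 : 𝔫 ≠ 0)

/-- `e_{K(𝔫)} ⊗ 1` on `W ⊗ E_λ(ℂ)`. [cite: BorelWallach2000, I §5.1] -/
def levelProjT : π.W ⊗[ℂ] ResGLnCohomology.CoeffModule ℂ n K lam →ₗ[ℂ]
    π.W ⊗[ℂ] ResGLnCohomology.CoeffModule ℂ n K lam :=
  (levelProj π h𝔫).rTensor (ResGLnCohomology.CoeffModule ℂ n K lam)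

/-- Unfolding. [folklore] -/
theorem levelProjT_apply (t : π.W ⊗[ℂ] ResGLnCohomology.CoeffModule ℂ n K lam) :
    levelProjT π lam h𝔫 t = (levelProj π h𝔫).rTensor (ResGLnCohomology.CoeffModule ℂ n K lam) t :=
  rfl

set_option maxHeartbeats 400000 in
-- the `𝔤`-action is an abbrev tower over the datum
/-- `e_{K(𝔫)} ⊗ 1` commutes with the Leibniz action `X ⊗ 1 + 1 ⊗ σ(X)` of `𝔤`. [cite: BorelWallach2000, I §5.1] -/
theorem levelProjT_comp_lie (X : (AutomorphyDatum.gl n K hcpt).arch.lie) :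
    levelProjT π lam h𝔫 ∘ₗ GKTensor.lie (AutomorphyDatum.gl n K hcpt).arch π.lieRepW (σ𝔤S hcpt lam) X =
      GKTensor.lie (AutomorphyDatum.gl n K hcpt).arch π.lieRepW (σ𝔤S hcpt lam) X ∘ₗ levelProjT π lam h𝔫 := by
  have hcomm : levelProj π h𝔫 ∘ₗ π.lieRepW X = π.lieRepW X ∘ₗ levelProj π h𝔫 :=
    LinearMap.ext fun φ => levelProj_lieRepW π h𝔫 X φ
  rw [GKTensor.lie_apply, LinearMap.comp_add, LinearMap.add_comp, levelProjT, ← LinearMap.rTensor_comp,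
    hcomm, LinearMap.rTensor_comp, LinearMap.rTensor_comp_lTensor, LinearMap.lTensor_comp_rTensor]

set_option maxHeartbeats 400000 in
-- the `K_∞`-action is an abbrev tower over the datum
/-- `e_{K(𝔫)} ⊗ 1` commutes with the diagonal action `r(k) ⊗ E(k)` of `K_∞`. [cite: BorelWallach2000, I §5.1] -/
theorem levelProjT_comp_tprod (k : (AutomorphyDatum.gl n K hcpt).arch.maximalCompact) :
    levelProjT π lam h𝔫 ∘ₗ (π.kRepW.tprod (σSK hcpt S lam)) k =
      (π.kRepW.tprod (σSK hcpt S lam)) k ∘ₗ levelProjT π lam h𝔫 := by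
  have hcomm : levelProj π h𝔫 ∘ₗ π.kRepW k = π.kRepW k ∘ₗ levelProj π h𝔫 :=
    LinearMap.ext fun φ => levelProj_kRepW π h𝔫 k φ
  rw [Representation.tprod_apply, levelProjT, LinearMap.rTensor_comp_map, LinearMap.map_comp_rTensor, hcomm]

/-- `e_{K(𝔫)} ⊗ 1` as an endomorphism of the `𝔤`-module `W ⊗ E` (the carrier of the complex).
[cite: BorelWallach2000, I §5.1] -/
def levelProjHom : Carrier π lam →ₗ⁅ℝ,(AutomorphyDatum.gl n K hcpt).arch.lie⁆ Carrier π lam :=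
  GKCarrier.hom (AutomorphyDatum.gl n K hcpt).arch
    (GKTensor.lie (AutomorphyDatum.gl n K hcpt).arch π.lieRepW (σ𝔤S hcpt lam))
    (GKTensor.lie (AutomorphyDatum.gl n K hcpt).arch π.lieRepW (σ𝔤S hcpt lam))
    (levelProjT π lam h𝔫) (levelProjT_comp_lie π lam h𝔫)

/-- **The cochain map `η ↦ (e_{K(𝔫)} ⊗ 1) ∘ η`** on `q`-cochains. [cite: BorelWallach2000, I §5.1] -/
def levelProjCochain (q : ℕ) : Cochain π lam q →ₗ[ℝ] Cochain π lam q :=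
  Literature.Algebra.Lie.ChevalleyEilenberg.map (AutomorphyDatum.gl n K hcpt).arch.lie (levelProjHom π lam h𝔫) q

/-- Unfolding: `(levelProjCochain η) v = (e ⊗ 1) (η v)`. [folklore] -/
theorem levelProjCochain_apply (q : ℕ) (η : Cochain π lam q) (v : Fin q → (AutomorphyDatum.gl n K hcpt).arch.lie) :
    @id (π.W ⊗[ℂ] ResGLnCohomology.CoeffModule ℂ n K lam) (levelProjCochain π lam h𝔫 q η v) =
      levelProjT π lam h𝔫 (@id (π.W ⊗[ℂ] ResGLnCohomology.CoeffModule ℂ n K lam) (η v)) :=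
  rfl

set_option maxHeartbeats 800000 in
-- `gkComplexLS` is an abbrev tower over the datum
/-- **`η ↦ (e_{K(𝔫)} ⊗ 1) ∘ η` is a cochain map of the `(𝔤, K_∞)`-complex `gkComplexLS π S λ` to itself**
(it commutes with `d` and preserves the complex). [cite: BorelWallach2000, I §5.1] -/
theorem isCochainMapTo_levelProjCochain :
    (gkComplexLS π S lam).IsCochainMapTo (gkComplexLS π S lam) (levelProjCochain π lam h𝔫) := by
  -- elaborate the generic cochain map first, then match it with `levelProjCochain` (definitional)
  have h :=
    isCochainMapTo_hom (AutomorphyDatum.gl n K hcpt).arch (π.kRepW.tprod (σSK hcpt S lam))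
      (GKTensor.lie (AutomorphyDatum.gl n K hcpt).arch π.lieRepW (σ𝔤S hcpt lam))
      (π.kRepW.tprod (σSK hcpt S lam))
      (GKTensor.lie (AutomorphyDatum.gl n K hcpt).arch π.lieRepW (σ𝔤S hcpt lam))
      (GKTensor.ad_compat (AutomorphyDatum.gl n K hcpt).arch π.kRepW π.lieRepW (σSK hcpt S lam) (σ𝔤S hcpt lam)
        π.kRepW_lieRepW_ad_compat (σS_ad_compat S lam))
      (GKTensor.ad_compat (AutomorphyDatum.gl n K hcpt).arch π.kRepW π.lieRepW (σSK hcpt S lam) (σ𝔤S hcpt lam)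
        π.kRepW_lieRepW_ad_compat (σS_ad_compat S lam))
      (levelProjT π lam h𝔫) (levelProjT_comp_lie π lam h𝔫) (levelProjT_comp_tprod π S lam h𝔫)
  exact h

/-- The values of `(e_{K(𝔫)} ⊗ 1) ∘ η` are `K(𝔫)`-fixed: `levelProjCochain η` is level-fixed.
[cite: BorelWallach2000, I §5.1] -/
theorem isLevelFixed_levelProjCochain (q : ℕ) (η : Cochain π lam q) :
    IsLevelFixed π lam 𝔫 (levelProjCochain π lam h𝔫 q η) := by
  intro w u hu
  rw [levelProjCochain_apply, levelProjT_apply, ← LinearMap.comp_apply, ← LinearMap.rTensor_comp,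
    finiteRepW_comp_levelProj π h𝔫 (ofFinite_mem_levelFin hu)]

/-- **`e_{K(𝔫)} ⊗ 1` as a normalised finite sum of right translations**: for every `t ∈ W ⊗ E` there is
an open subgroup `T₀ ≤ G(𝔸_f)` such that for every open `T ≤ T₀` and every transversal `R` of
`K(𝔫) / (K(𝔫) ∩ T)`, `(e ⊗ 1) t = #R⁻¹ ∑_{r ∈ R} (r ⊗ 1) t` (induction on `t`: for a pure tensor
`φ ⊗ e` take `T₀ = Stab φ`, for a sum the intersection). [cite: BernsteinZelevinsky1976, §2.3] -/
theorem exists_levelProjT_eq_sum (t : π.W ⊗[ℂ] ResGLnCohomology.CoeffModule ℂ n K lam) :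
    ∃ T₀ : Subgroup (AutomorphyDatum.gl n K hcpt).finiteAdelic,
      IsOpen (T₀ : Set (AutomorphyDatum.gl n K hcpt).finiteAdelic) ∧
        ∀ (T : Subgroup (AutomorphyDatum.gl n K hcpt).finiteAdelic), T ≤ T₀ →
          IsOpen (T : Set (AutomorphyDatum.gl n K hcpt).finiteAdelic) →
          ∀ R : Finset (AutomorphyDatum.gl n K hcpt).finiteAdelic,
            IsLeftTransversal (levelFin n K hcpt 𝔫) (levelFin n K hcpt 𝔫 ⊓ T) R →
              levelProjT π lam h𝔫 t =
                (R.card : ℂ)⁻¹ • ∑ r ∈ R, (π.finiteRepW r).rTensor (ResGLnCohomology.CoeffModule ℂ n K lam) t := by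
  induction t using TensorProduct.induction_on with
  | zero =>
    refine ⟨⊤, isOpen_univ, fun T _ _ R _ => ?_⟩
    simp only [map_zero, Finset.sum_const_zero, smul_zero]
  | tmul φ e =>
    refine ⟨π.finiteRepW.stabilizerSubgroup φ, finiteRepW_isSmooth π φ, fun T hT hTo R hR => ?_⟩
    have hTφ : ∀ t ∈ T, π.finiteRepW t φ = φ := fun t ht => hT ht
    rw [levelProjT_apply, LinearMap.rTensor_tmul, levelProj_apply,
      Representation.avgProj_eq (isCompact_levelFin h𝔫) hTo hTφ hR, ← TensorProduct.smul_tmul',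
      TensorProduct.sum_tmul]
    simp only [LinearMap.rTensor_tmul]
  | add t t' ht ht' =>
    obtain ⟨T₁, hT₁, h₁⟩ := ht
    obtain ⟨T₂, hT₂, h₂⟩ := ht'
    refine ⟨T₁ ⊓ T₂, hT₁.inter hT₂, fun T hT hTo R hR => ?_⟩
    rw [map_add, h₁ T (hT.trans inf_le_left) hTo R hR, h₂ T (hT.trans inf_le_right) hTo R hR, ← smul_add,
      ← Finset.sum_add_distrib]
    simp only [map_add]

/-- **`e_{K(𝔫)} ⊗ 1` is the identity on `K(𝔫)`-fixed tensors.** [cite: BernsteinZelevinsky1976, §2.3] -/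
theorem levelProjT_eq_self {t : π.W ⊗[ℂ] ResGLnCohomology.CoeffModule ℂ n K lam}
    (ht : ∀ u ∈ levelFin n K hcpt 𝔫, (π.finiteRepW u).rTensor (ResGLnCohomology.CoeffModule ℂ n K lam) t = t) :
    levelProjT π lam h𝔫 t = t := by
  obtain ⟨T₀, hT₀, h⟩ := exists_levelProjT_eq_sum π lam h𝔫 t
  obtain ⟨R, hR⟩ := exists_isLeftTransversal (B := levelFin n K hcpt 𝔫) (isCompact_levelFin h𝔫) hT₀
  rw [h T₀ le_rfl hT₀ R hR]
  have hsum : ∑ r ∈ R, (π.finiteRepW r).rTensor (ResGLnCohomology.CoeffModule ℂ n K lam) t = R.card • t := by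
    rw [← Finset.sum_const]
    exact Finset.sum_congr rfl fun r hr => ht r (hR.mem_of_mem r hr)
  rw [hsum, ← Nat.cast_smul_eq_nsmul ℂ, smul_smul,
    inv_mul_cancel₀ (Nat.cast_ne_zero.2 (Finset.card_ne_zero.2 hR.nonempty)), one_smul]

/-- **`(e_{K(𝔫)} ⊗ 1) ∘ η = η` for a level-fixed cochain `η`.** [cite: BorelWallach2000, I §5.1] -/
theorem levelProjCochain_eq_self (q : ℕ) {η : Cochain π lam q} (hη : IsLevelFixed π lam 𝔫 η) :
    levelProjCochain π lam h𝔫 q η = η := by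
  refine AlternatingMap.ext fun v => ?_
  change levelProjT π lam h𝔫 (@id (π.W ⊗[ℂ] ResGLnCohomology.CoeffModule ℂ n K lam) (η v)) =
    @id (π.W ⊗[ℂ] ResGLnCohomology.CoeffModule ℂ n K lam) (η v)
  refine levelProjT_eq_self π lam h𝔫 fun u hu => ?_
  obtain ⟨u', hu', rfl⟩ := exists_eq_ofFinite_of_mem_levelFin hu
  exact hη v u' hu'

end Tensor

/-! ### Reduction of the apex fact to the level-fixed subcomplex -/

section Reduction

open Literature.NumberTheory.DiophantineGeometry Literature.Barriers.Langlands

variable {𝔫 : Ideal (𝓞 K)}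

/-- **A level-fixed cochain which is not the coboundary of a LEVEL-FIXED cochain of the complex is not
a coboundary**: if `η = dβ` with `β ∈ C^q(𝔤, K_∞; W ⊗ E)`, then `β' = (e_{K(𝔫)} ⊗ 1) ∘ β` is a
level-fixed cochain of the complex with `dβ' = (e_{K(𝔫)} ⊗ 1) ∘ dβ = (e_{K(𝔫)} ⊗ 1) ∘ η = η`.  This is
the step "`W^{K_f}` is a `(𝔤, K_∞)`-direct summand of `W`" behind
`H^•(𝔤, K_∞; W^{K_f} ⊗ E) = H^•(𝔤, K_∞; π_∞ ⊗ E) ⊗ π_f^{K_f} ↪ H^•(𝔤, K_∞; W ⊗ E)`.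
[cite: Clozel1990, §3.5 (pp. 121–123)] [cite: BorelWallach2000, I §5.1] -/
theorem not_mem_coboundaries_of_isLevelFixed (h𝔫 : 𝔫 ≠ 0) {q : ℕ} {η : Cochain π lam (q + 1)}
    (hη : IsLevelFixed π lam 𝔫 η)
    (hne : ∀ β ∈ (gkComplexLS π S lam).carrier q, IsLevelFixed π lam 𝔫 β →
      Literature.Algebra.Lie.ChevalleyEilenberg.d ℝ (AutomorphyDatum.gl n K hcpt).arch.lie (Carrier π lam) q β ≠ η) :
    η ∉ (gkComplexLS π S lam).coboundaries (q + 1) := by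
  intro hmem
  obtain ⟨β, hβ, hdβ⟩ := ((gkComplexLS π S lam).mem_coboundaries_succ_iff q η).1 hmem
  have hmap := isCochainMapTo_levelProjCochain π S lam h𝔫
  refine hne (levelProjCochain π lam h𝔫 q β) (hmap.mapsTo q β hβ) (isLevelFixed_levelProjCochain π lam h𝔫 q β) ?_
  rw [hmap.comm q β, hdβ, levelProjCochain_eq_self π lam h𝔫 (q + 1) hη]

/-- **The apex fact `Clozel1990_exists_basic_levelFixed_cocycle` follows from its LEVEL-FIXED form**:
it suffices to produce, for every clean cohomological cuspidal `π` with a `K(𝔫)`-fixed vector, a basic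
level-fixed cocycle `η ∈ C^{q+1}(𝔤, K_∞; W ⊗ (E_λ ⊗ ε_S))` which is not the coboundary of a
LEVEL-FIXED `q`-cochain of the complex (i.e. a non-zero class of the complex of the
`(𝔤, K_∞)`-module `W^{K(𝔫)} ⊗ E` with a basic representative) — the shape in which the printed proof
delivers it (`H^•(𝔤, K_∞; π_∞ ⊗ E) ⊗ π_f^{K_f}`). [cite: Clozel1990, Lemme 3.14 (p. 114) and §3.5 (pp. 121–123)]
[cite: BorelWallach2000, I §5.1] -/
theorem Clozel1990_exists_basic_levelFixed_cocycle_of_levelSubcomplex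
    (H : ∀ (n : ℕ) (K : Type) [Field K] [NumberField K] (hcpt : isCompact_glFiniteIntegralLevel n K)
      (𝔫 : Ideal (𝓞 K)) (lam : (K →+* ℂ) → Fin n → ℤ), 2 ≤ n → 𝔫 ≠ 0 →
      (∀ τ, Weight.IsDominant (lam τ)) →
      ∀ π : CuspidalAutomorphicRepData n K hcpt, π.1.W' = ⊥ →
        (∃ μ : ℂ, ∀ c ∈ π.1.W, lieDeriv (AutomorphyDatum.gl n K hcpt).ofArch
          (⟨1, trivial⟩ : (AutomorphyDatum.gl n K hcpt).arch.lie) c = μ • c) →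
        (∃ T : InfinityType K n, π.1.HasInfinityType T ∧
          ∀ τ : K →+* ℂ, (T τ).map ArchWeight.a =
            (cohomologicalInfinityType n K (Weight.dual (lam τ)) τ).map ArchWeight.a) →
        (∃ φ ∈ π.1.W, φ ≠ 0 ∧
          ∀ u ∈ principalCongruenceLevel n K 𝔫, rightTranslation (AdelicGroupData.gl n K) u φ = φ) →
        ∃ (S : Finset {w : InfinitePlace K // w.IsReal}) (q : ℕ) (η : Cochain π.1 lam (q + 1)),
          η ∈ (gkComplexLS π.1 S lam).cocycles (q + 1) ∧
            IsLevelFixed π.1 lam 𝔫 η ∧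
              Literature.Algebra.Lie.ChevalleyEilenberg.ins q
                  (⟨1, trivial⟩ : (AutomorphyDatum.gl n K hcpt).arch.lie) η = 0 ∧
                ∀ β ∈ (gkComplexLS π.1 S lam).carrier q, IsLevelFixed π.1 lam 𝔫 β →
                  Literature.Algebra.Lie.ChevalleyEilenberg.d ℝ (AutomorphyDatum.gl n K hcpt).arch.lie
                    (Carrier π.1 lam) q β ≠ η) :
    Clozel1990_exists_basic_levelFixed_cocycle := by
  intro n K _ _ hcpt 𝔫 lam hn h𝔫 hdom π hW' hμ hT hφ
  obtain ⟨S, q, η, hηZ, hfix, hins, hne⟩ := H n K hcpt 𝔫 lam hn h𝔫 hdom π hW' hμ hT hφ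
  exact ⟨S, q, η, hηZ, hfix, hins, not_mem_coboundaries_of_isLevelFixed π.1 S lam h𝔫 hfix hne⟩

end Reduction

end ConeDictionary

end Literature.NumberTheory.Automorphic
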